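import Summits.AnomalousDissipation.AnomalousDissipation.Theorems.MarginalStabilityChainStrainedLayerLawClockEnstrophyWindowCeiling
import HarnessLib

/-!
# Crux `MarginalStabilityChain.StrainedLayerLaw` (stmt-AnomalousDissipation-3007), line `FirstLemmasR2K4`
# (log-enstrophy clock + Nash roundness): the exact total-enstrophy clock — tools (the enstrophy identity)

Support file (`--supports stmt-AnomalousDissipation-3007`; registered sub-goal `enstrophyClock_identity`, the tools of
the registered sub-goal `enstrophy_clock_exact` of line `FirstLemmasR2K4`, lead c7, wave 2).

What it proves: for every classical solution `(u, v, p)` of the stretched two-dimensional Navier–Stokes layer class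
`IsStretchedLayerNSSolutionOn (Ioi 0) ν 1 1 L u v p` (`ν, L > 0`) with uniform exponential shear tails on every compact
time interval `[a, b] ⊂ (0, ∞)`, the TOTAL-ENSTROPHY IDENTITY

  `Ω(t) − Ω(s) = ∫_s^t (Ω(τ) − 2νP(τ)) dτ`,  `0 < s ≤ t`,

with `Ω(τ) = ∫_{(0,L]}∫_ℝ ω(τ)²` the total enstrophy and `P(τ) = ∫_{(0,L]}∫_ℝ |∇ω(τ)|²` the palinstrophy of one period
strip (`ω = ∂ₓv − ∂_yu`; iterated Bochner integrals). It is the enstrophy balance of the class (stretching rate `1`: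
transport by `(u, v − y)`, `div = −1`, and stretching `+ω` give `ωF′(ω) − F(ω) = ω²` for `F(r) = r²`), as an
equality (wave 1's `enstrophy_window_ceiling` had only `Ω(t) ≤ e^{t−s}Ω(s)`).

Route (the `F(r) = r²`, `ε = 0` case of the renormalised balance of the clock line, tools B–E of
`stub_negEnstrophyLaw`): `stub_negEnstrophyLaw_level` with `F(r) = r²` and the cutoff
`ψ_{1/ε}(y) = σ(2 − εy)σ(2 + εy)` gives `|N(t) − N(s) − ∫_s^t (A − νC)| = O(ε)` with `N = A = ∫∫ω²ψ`, `C = 2∫∫|∇ω|²ψ`;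
`ε → 0⁺` by dominated convergence at each instant (`ω² ≤ C²e^{−k|y|}`, `|∇ω|² ≤ 2C²e^{−k|y|}`, `ψ → 1`:
`enstrophyClock_limit_N/C`) and in time (uniform bounds `enstrophyClock_A/C_abs_le`); Fubini returns to the iterated
functionals. All `[folklore]` (enstrophy balance of 2-D Navier–Stokes: Majda–Bertozzi 2002, §1.4 and §3.1.1, for the
stretched class; Ben-Artzi, Arch. Rational Mech. Anal. 128 (1994)).
-/

-- `Summit.<Summit>.<Problem>` is the tree's mandated summit-side namespace (CONVENTIONS §2); for this
-- single-conjunct summit the two coincide, so the duplicate is deliberate.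
set_option linter.dupNamespace false

noncomputable section

open scoped Topology ENNReal
open Filter Set Function MeasureTheory

namespace Summit.AnomalousDissipation.AnomalousDissipation.Theorems.StrainedLayerLaw.LogEnstrophyClock

open Literature.Analysis.FluidPDE Literature.Analysis.FluidPDE.StretchedLayer
open Summit.AnomalousDissipation.AnomalousDissipation.Theses.MarginalStabilityChain
open Summit.AnomalousDissipation.AnomalousDissipation.Theorems.StrainedLayerLaw.StrainWorkSumRule
/-! ## Slice facts: palinstrophy integrand, cutoff limits, uniform bounds -/

section SliceFacts

variable {L C k : ℝ} {f g : ℝ → ℝ → ℝ}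

/-- `|∇ω|²` is integrable on the period strip under shear tails (`|∇ω|² ≤ 2C²e^{−k|y|}`). [folklore] -/
theorem enstrophyClock_integrableOn_gradSq (hk : 0 < k) (hT : SliceTails C k f g)
    (hf : ContDiff ℝ 2 (fun q : ℝ × ℝ => f q.1 q.2)) (hg : ContDiff ℝ 2 (fun q : ℝ × ℝ => g q.1 q.2))
    (hdiv : ∀ x y, dX f x y + dY g x y = 0) :
    IntegrableOn (fun q : ℝ × ℝ => dX (vorticity f g) q.1 q.2 ^ 2 + dY (vorticity f g) q.1 q.2 ^ 2)
      (Ioc 0 L ×ˢ univ) := by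
  have hω1 : ContDiff ℝ 1 (fun q : ℝ × ℝ => vorticity f g q.1 q.2) := contDiff_one_vorticity hf hg
  refine clock_integrableOn_strip_of_le (C := 2 * C ^ 2)
    (((continuous_dX hω1).pow 2).add ((continuous_dY hω1).pow 2)).aestronglyMeasurable hk fun q => ?_
  rw [abs_of_nonneg (by positivity)]
  exact clock_grad_vorticity_sq_le hk hT hf hg hdiv q.1 q.2

/-- **Removal of the cutoff in `Ω`**: `∫∫ ω²ψ_{1/ε} → ∫∫ ω²` as `ε → 0⁺` (dominated convergence, `|ψ| ≤ 1`, `ψ → 1`,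
`ω² ≤ C²e^{−k|y|}`). [folklore] -/
theorem enstrophyClock_limit_N (hk : 0 < k) (hT : SliceTails C k f g)
    (hf : ContDiff ℝ 2 (fun q : ℝ × ℝ => f q.1 q.2)) (hg : ContDiff ℝ 2 (fun q : ℝ × ℝ => g q.1 q.2)) :
    Tendsto (fun ε : ℝ => ∫ q in Ioc 0 L ×ˢ univ, vorticity f g q.1 q.2 ^ 2 *
        (Real.smoothTransition (2 - q.2 / ε⁻¹) * Real.smoothTransition (2 + q.2 / ε⁻¹))) (𝓝[>] 0)
      (𝓝 (∫ q in Ioc 0 L ×ˢ univ, vorticity f g q.1 q.2 ^ 2)) := by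
  have cω : Continuous fun q : ℝ × ℝ => vorticity f g q.1 q.2 := (contDiff_one_vorticity hf hg).continuous
  refine tendsto_integral_filter_of_dominated_convergence (fun q => C ^ 2 * Real.exp (-k * |q.2|)) ?_ ?_ ?_ ?_
  · exact Eventually.of_forall fun ε =>
      ((cω.pow 2).mul ((kato_cutoff_contDiff ε⁻¹).continuous.comp continuous_snd)).aestronglyMeasurable
  · refine Eventually.of_forall fun ε => Eventually.of_forall fun q => ?_
    rw [Real.norm_eq_abs, abs_mul, abs_of_nonneg (sq_nonneg _)]
    calc _ ≤ vorticity f g q.1 q.2 ^ 2 * 1 :=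
          mul_le_mul_of_nonneg_left (kato_cutoff_abs_le_one ε⁻¹ q.2) (sq_nonneg _)
      _ ≤ C ^ 2 * Real.exp (-k * |q.2|) := by rw [mul_one]; exact clock_vorticity_sq_le hk hT q.1 q.2
  · exact (kato_integrableOn_weight hk L).const_mul _
  · refine Eventually.of_forall fun q => ?_
    have h := (tendsto_const_nhds (x := vorticity f g q.1 q.2 ^ 2) (f := (𝓝[>] (0:ℝ)))).mul
      (clock_cutoff_tendsto_one q.2)
    rwa [mul_one] at h

/-- **Removal of the cutoff in `P`**: `∫∫ 2|∇ω|²ψ_{1/ε} → 2∫∫ |∇ω|²` as `ε → 0⁺` (dominated convergence,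
`|∇ω|² ≤ 2C²e^{−k|y|}`). [folklore] -/
theorem enstrophyClock_limit_C (hk : 0 < k) (hT : SliceTails C k f g)
    (hf : ContDiff ℝ 2 (fun q : ℝ × ℝ => f q.1 q.2)) (hg : ContDiff ℝ 2 (fun q : ℝ × ℝ => g q.1 q.2))
    (hdiv : ∀ x y, dX f x y + dY g x y = 0) :
    Tendsto (fun ε : ℝ => ∫ q in Ioc 0 L ×ˢ univ,
      2 * (dX (vorticity f g) q.1 q.2 ^ 2 + dY (vorticity f g) q.1 q.2 ^ 2) *
        (Real.smoothTransition (2 - q.2 / ε⁻¹) * Real.smoothTransition (2 + q.2 / ε⁻¹))) (𝓝[>] 0)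
      (𝓝 (2 * ∫ q in Ioc 0 L ×ˢ univ, (dX (vorticity f g) q.1 q.2 ^ 2 + dY (vorticity f g) q.1 q.2 ^ 2))) := by
  have hω1 : ContDiff ℝ 1 (fun q : ℝ × ℝ => vorticity f g q.1 q.2) := contDiff_one_vorticity hf hg
  have cP : Continuous fun q : ℝ × ℝ => dX (vorticity f g) q.1 q.2 ^ 2 + dY (vorticity f g) q.1 q.2 ^ 2 :=
    ((continuous_dX hω1).pow 2).add ((continuous_dY hω1).pow 2)
  rw [← integral_const_mul]
  refine tendsto_integral_filter_of_dominated_convergence (fun q => 4 * C ^ 2 * Real.exp (-k * |q.2|)) ?_ ?_ ?_ ?_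
  · exact Eventually.of_forall fun ε =>
      ((continuous_const.mul cP).mul ((kato_cutoff_contDiff ε⁻¹).continuous.comp continuous_snd)).aestronglyMeasurable
  · refine Eventually.of_forall fun ε => Eventually.of_forall fun q => ?_
    rw [Real.norm_eq_abs, abs_mul, abs_of_nonneg (by positivity)]
    calc _ ≤ 2 * (2 * C ^ 2 * Real.exp (-k * |q.2|)) * 1 :=
          mul_le_mul (mul_le_mul_of_nonneg_left (clock_grad_vorticity_sq_le hk hT hf hg hdiv q.1 q.2) zero_le_two)
            (kato_cutoff_abs_le_one ε⁻¹ q.2) (abs_nonneg _) (by positivity)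
      _ = 4 * C ^ 2 * Real.exp (-k * |q.2|) := by ring
  · exact (kato_integrableOn_weight hk L).const_mul _
  · refine Eventually.of_forall fun q => ?_
    have h := (tendsto_const_nhds (x := 2 * (dX (vorticity f g) q.1 q.2 ^ 2 + dY (vorticity f g) q.1 q.2 ^ 2))
      (f := (𝓝[>] (0:ℝ)))).mul (clock_cutoff_tendsto_one q.2)
    rwa [mul_one] at h

/-- Uniform bound: `|∫∫ (ω·2ω − ω²)ψ_R| ≤ C²∫∫e^{−k|y|}` (`|ψ_R| ≤ 1`, `ω² ≤ C²e^{−k|y|}`). [folklore] -/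
theorem enstrophyClock_A_abs_le (hk : 0 < k) (hT : SliceTails C k f g) (R : ℝ) :
    |∫ q in Ioc 0 L ×ˢ univ, (vorticity f g q.1 q.2 * (2 * vorticity f g q.1 q.2) - vorticity f g q.1 q.2 ^ 2) *
      (Real.smoothTransition (2 - q.2 / R) * Real.smoothTransition (2 + q.2 / R))| ≤
      C ^ 2 * ∫ q in Ioc 0 L ×ˢ univ, Real.exp (-k * |q.2|) := by
  rw [← integral_const_mul, ← Real.norm_eq_abs]
  refine norm_integral_le_of_norm_le ((kato_integrableOn_weight hk L).const_mul _) (Eventually.of_forall fun q => ?_)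
  rw [Real.norm_eq_abs, abs_mul, show vorticity f g q.1 q.2 * (2 * vorticity f g q.1 q.2) - vorticity f g q.1 q.2 ^ 2 =
    vorticity f g q.1 q.2 ^ 2 by ring, abs_of_nonneg (sq_nonneg _)]
  calc _ ≤ vorticity f g q.1 q.2 ^ 2 * 1 :=
        mul_le_mul_of_nonneg_left (kato_cutoff_abs_le_one R q.2) (sq_nonneg _)
    _ ≤ C ^ 2 * Real.exp (-k * |q.2|) := by rw [mul_one]; exact clock_vorticity_sq_le hk hT q.1 q.2

/-- Uniform bound: `|∫∫ 2|∇ω|²ψ_R| ≤ 4C²∫∫e^{−k|y|}`. [folklore] -/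
theorem enstrophyClock_C_abs_le (hk : 0 < k) (hT : SliceTails C k f g) (hf : ContDiff ℝ 2 (fun q : ℝ × ℝ => f q.1 q.2))
    (hg : ContDiff ℝ 2 (fun q : ℝ × ℝ => g q.1 q.2)) (hdiv : ∀ x y, dX f x y + dY g x y = 0) (R : ℝ) :
    |∫ q in Ioc 0 L ×ˢ univ, 2 * (dX (vorticity f g) q.1 q.2 ^ 2 + dY (vorticity f g) q.1 q.2 ^ 2) *
      (Real.smoothTransition (2 - q.2 / R) * Real.smoothTransition (2 + q.2 / R))| ≤
      4 * C ^ 2 * ∫ q in Ioc 0 L ×ˢ univ, Real.exp (-k * |q.2|) := by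
  rw [← integral_const_mul, ← Real.norm_eq_abs]
  refine norm_integral_le_of_norm_le ((kato_integrableOn_weight hk L).const_mul _) (Eventually.of_forall fun q => ?_)
  rw [Real.norm_eq_abs, abs_mul, abs_of_nonneg (by positivity)]
  calc _ ≤ 2 * (2 * C ^ 2 * Real.exp (-k * |q.2|)) * 1 :=
        mul_le_mul (mul_le_mul_of_nonneg_left (clock_grad_vorticity_sq_le hk hT hf hg hdiv q.1 q.2) zero_le_two)
          (kato_cutoff_abs_le_one R q.2) (abs_nonneg _) (by positivity)
    _ = 4 * C ^ 2 * Real.exp (-k * |q.2|) := by ring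

end SliceFacts

/-! ## The registered tools sub-goal: the total-enstrophy identity `Ω(t) − Ω(s) = ∫_s^t (Ω − 2νP)` -/

section Identity

/-- **The total-enstrophy balance in integral form (registered sub-goal `enstrophyClock_identity`).** Along every
classical solution of the stretched layer class on `(0, ∞)` (`ν, L > 0`) with shear tails on compact time intervals, `Ω(t′) − Ω(s) = ∫_s^{t′} (Ω(τ) − 2νP(τ)) dτ` for `0 < s ≤ t′`, `Ω = ∫∫ω²`,
`P = ∫∫|∇ω|²` (iterated over the period strip): tools D of the clock line (`stub_negEnstrophyLaw_level`) with
`F(r) = r²`, `ε = 0` and the cutoff `ψ_{1/ε}` give `|N(t′) − N(s) − ∫_s^{t′}(A − νC)| = O(ε)` with `N = A = ∫∫ω²ψ`,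
`C = 2∫∫|∇ω|²ψ`; `ε → 0⁺` by dominated convergence at each instant (`enstrophyClock_limit_N/C`) and in time; Fubini
returns to the iterated functionals. [folklore] -/
theorem enstrophyClock_identity : ∀ (ν L : ℝ), 0 < ν → 0 < L → ∀ (u v p : ℝ → ℝ → ℝ → ℝ),
    IsStretchedLayerNSSolutionOn (Ioi 0) ν 1 1 L u v p → (∀ a b : ℝ, 0 < a → a < b → ExpTails (Icc a b) u v) →
    ∀ s t : ℝ, 0 < s → s ≤ t → (∫ x in Ioc 0 L, ∫ y, vorticity (u t) (v t) x y ^ 2) -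
      (∫ x in Ioc 0 L, ∫ y, vorticity (u s) (v s) x y ^ 2) =
      ∫ τ in s..t, ((∫ x in Ioc 0 L, ∫ y, vorticity (u τ) (v τ) x y ^ 2) -
        2 * ν * ∫ x in Ioc 0 L, ∫ y, (dX (vorticity (u τ) (v τ)) x y ^ 2 + dY (vorticity (u τ) (v τ)) x y ^ 2)) := by
  intro ν L hν hL u v p hsol htails s t' hs hst
  obtain ⟨C, k, hk, hCk⟩ := htails (s / 2) (t' + 1) (by positivity) (by linarith)
  have hST : ∀ τ ∈ Icc s t', SliceTails C k (u τ) (v τ) := fun τ hτ =>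
    (hCk τ ⟨by linarith [hτ.1], by linarith [hτ.2]⟩).1
  obtain ⟨Cσ, hCσ0, hCσ⟩ := kato_smoothTransition_deriv_bound
  have hpos : ∀ {τ : ℝ}, τ ∈ Icc s t' → 0 < τ := fun hτ => hs.trans_le hτ.1
  have hu2 : ∀ {τ : ℝ}, 0 < τ → ContDiff ℝ 2 (fun q : ℝ × ℝ => u τ q.1 q.2) := fun hτ => hsol.contDiff_u (mem_Ioi.2 hτ)
  have hv2 : ∀ {τ : ℝ}, 0 < τ → ContDiff ℝ 2 (fun q : ℝ × ℝ => v τ q.1 q.2) := fun hτ => hsol.contDiff_v (mem_Ioi.2 hτ)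
  have hdiv : ∀ {τ : ℝ}, 0 < τ → ∀ x y, dX (u τ) x y + dY (v τ) x y = 0 := fun hτ => hsol.divFree _ (mem_Ioi.2 hτ)
  have hIsub : uIoc s t' ⊆ Ioi 0 := fun τ hτ => by rw [uIoc_of_le hst] at hτ; exact hs.trans hτ.1
  -- the weights and the strip functionals
  set IW : ℝ := ∫ q in Ioc 0 L ×ˢ univ, (C + |q.2|) * Real.exp (-k * |q.2|) with hIW
  set Ik : ℝ := ∫ q in Ioc 0 L ×ˢ univ, Real.exp (-k * |q.2|) with hIk
  set ψq : ℝ → ℝ → ℝ := fun ε y => Real.smoothTransition (2 - y / ε⁻¹) * Real.smoothTransition (2 + y / ε⁻¹) with hψq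
  set N : ℝ → ℝ → ℝ := fun ε τ => ∫ q in Ioc 0 L ×ˢ univ, vorticity (u τ) (v τ) q.1 q.2 ^ 2 * ψq ε q.2 with hN
  set A : ℝ → ℝ → ℝ := fun ε τ => ∫ q in Ioc 0 L ×ˢ univ, (vorticity (u τ) (v τ) q.1 q.2 *
    (2 * vorticity (u τ) (v τ) q.1 q.2) - vorticity (u τ) (v τ) q.1 q.2 ^ 2) * ψq ε q.2 with hA
  set Cc : ℝ → ℝ → ℝ := fun ε τ => ∫ q in Ioc 0 L ×ˢ univ,
    2 * (dX (vorticity (u τ) (v τ)) q.1 q.2 ^ 2 + dY (vorticity (u τ) (v τ)) q.1 q.2 ^ 2) * ψq ε q.2 with hCc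
  set Ωs : ℝ → ℝ := fun τ => ∫ q in Ioc 0 L ×ˢ univ, vorticity (u τ) (v τ) q.1 q.2 ^ 2 with hΩs
  set Ps : ℝ → ℝ := fun τ => ∫ q in Ioc 0 L ×ˢ univ,
    (dX (vorticity (u τ) (v τ)) q.1 q.2 ^ 2 + dY (vorticity (u τ) (v τ)) q.1 q.2 ^ 2) with hPs
  -- (1) the level identity for `F(r) = r²` (`ε := 0` in tools D), cutoff `ψ_{1/ε}`, every `ε > 0`
  have hF : ∀ r : ℝ, HasDerivAt (fun r : ℝ => r ^ 2) (2 * r) r := fun r => by simpa using hasDerivAt_pow 2 r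
  have hF' : ∀ r : ℝ, HasDerivAt (fun r : ℝ => 2 * r) 2 r := fun r => by
    simpa using (hasDerivAt_id r).const_mul (2:ℝ)
  have hF'1 : ContDiff ℝ 1 (fun r : ℝ => 2 * r) := contDiff_const.mul contDiff_id
  have hFb : ∀ r : ℝ, |r ^ 2| ≤ |r| * (|r| + 0) := fun r => by rw [add_zero, abs_pow, sq]
  have hF'b : ∀ r : ℝ, |2 * r| ≤ 2 * (|r| + 0) := fun r => by rw [add_zero, abs_mul, abs_two]
  have hlevel : ∀ ε : ℝ, 0 < ε → |N ε t' - N ε s - ∫ τ in s..t', (A ε τ - ν * Cc ε τ)| ≤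
      (t' - s) * (2 * Cσ * ε * (C + 0) * C * (IW + 2 * ν * Ik)) := by
    intro ε hε
    have hR : 0 < ε⁻¹ := inv_pos.2 hε
    have h := stub_negEnstrophyLaw_level ν L u v p (fun r => r ^ 2) (fun r => 2 * r) (fun _ => 2)
      (ψq ε) 0 ε⁻¹ (2 * Cσ / ε⁻¹) C k s t' hsol hν.le hL hF hF' hF'1 continuous_const le_rfl hFb hF'b
      (kato_cutoff_contDiff ε⁻¹) (kato_cutoff_abs_le_one ε⁻¹) (fun y hy => kato_cutoff_eq_zero hR hy)
      (kato_cutoff_deriv_bound hR hCσ) (fun y hy => kato_cutoff_deriv_eq_zero_of_gt hR hy) hk hs hst hST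
    refine h.trans_eq ?_
    rw [div_inv_eq_mul]
  -- (2) the error tends to zero
  have herr : Tendsto (fun ε : ℝ => (t' - s) * (2 * Cσ * ε * (C + 0) * C * (IW + 2 * ν * Ik))) (𝓝[>] 0) (𝓝 0) := by
    have hc : Continuous fun ε : ℝ => (t' - s) * (2 * Cσ * ε * (C + 0) * C * (IW + 2 * ν * Ik)) := by fun_prop
    have h := hc.tendsto 0
    simp only [mul_zero, zero_mul] at h
    exact h.mono_left nhdsWithin_le_nhds
  have hΦ0 : Tendsto (fun ε : ℝ => N ε t' - N ε s - ∫ τ in s..t', (A ε τ - ν * Cc ε τ)) (𝓝[>] 0) (𝓝 0) := by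
    refine squeeze_zero_norm' ?_ herr
    filter_upwards [self_mem_nhdsWithin] with ε hε
    rw [Real.norm_eq_abs]
    exact hlevel ε hε
  -- (3) the limits of the three pieces
  have hNlim : ∀ {τ : ℝ}, τ ∈ Icc s t' → Tendsto (fun ε : ℝ => N ε τ) (𝓝[>] 0) (𝓝 (Ωs τ)) := fun {τ} hτ =>
    enstrophyClock_limit_N hk (hST τ hτ) (hu2 (hpos hτ)) (hv2 (hpos hτ))
  have hAN : ∀ ε τ, A ε τ = N ε τ := fun ε τ =>
    integral_congr_ae (Eventually.of_forall fun q => by beta_reduce; ring)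
  have hInt : Tendsto (fun ε : ℝ => ∫ τ in s..t', (A ε τ - ν * Cc ε τ)) (𝓝[>] 0)
      (𝓝 (∫ τ in s..t', (Ωs τ - ν * (2 * Ps τ)))) := by
    refine intervalIntegral.tendsto_integral_filter_of_dominated_convergence
      (fun _ => C ^ 2 * Ik + ν * (4 * C ^ 2 * Ik)) ?_ ?_ intervalIntegrable_const ?_
    · filter_upwards [self_mem_nhdsWithin] with ε hε
      have hε' : (0:ℝ) < ε := hε
      have hR : 0 < ε⁻¹ := inv_pos.2 hε'
      have hAc := clock_continuousOn_A (F := fun r : ℝ => r ^ 2) (F' := fun r : ℝ => 2 * r) hsol.contDiffOn_u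
        hsol.contDiffOn_v (continuous_pow 2) (continuous_const.mul continuous_id)
        (kato_cutoff_contDiff ε⁻¹).continuous (fun y hy => kato_cutoff_eq_zero hR hy) L
      have hCc' := clock_continuousOn_C (F'' := fun _ : ℝ => (2:ℝ)) hsol.contDiffOn_u hsol.contDiffOn_v
        continuous_const (kato_cutoff_contDiff ε⁻¹).continuous (fun y hy => kato_cutoff_eq_zero hR hy) L
      exact ((hAc.sub (continuousOn_const.mul hCc')).mono hIsub).aestronglyMeasurable measurableSet_uIoc
    · filter_upwards [self_mem_nhdsWithin] with ε hε
      have hε' : (0:ℝ) < ε := hε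
      refine Eventually.of_forall fun τ hτ => ?_
      rw [uIoc_of_le hst] at hτ
      have hτI : τ ∈ Icc s t' := ⟨hτ.1.le, hτ.2⟩
      have hτ0 : 0 < τ := hpos hτI
      have h1 : |A ε τ| ≤ C ^ 2 * Ik := enstrophyClock_A_abs_le hk (hST τ hτI) ε⁻¹
      have h2 : |Cc ε τ| ≤ 4 * C ^ 2 * Ik := enstrophyClock_C_abs_le hk (hST τ hτI) (hu2 hτ0) (hv2 hτ0) (hdiv hτ0) ε⁻¹
      rw [Real.norm_eq_abs]
      calc |A ε τ - ν * Cc ε τ| ≤ |A ε τ| + |ν * Cc ε τ| := abs_sub _ _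
        _ = |A ε τ| + ν * |Cc ε τ| := by rw [abs_mul, abs_of_pos hν]
        _ ≤ C ^ 2 * Ik + ν * (4 * C ^ 2 * Ik) := add_le_add h1 (mul_le_mul_of_nonneg_left h2 hν.le)
    · refine Eventually.of_forall fun τ hτ => ?_
      rw [uIoc_of_le hst] at hτ
      have hτI : τ ∈ Icc s t' := ⟨hτ.1.le, hτ.2⟩
      have hτ0 : 0 < τ := hpos hτI
      have hA' : Tendsto (fun ε : ℝ => A ε τ) (𝓝[>] 0) (𝓝 (Ωs τ)) := by
        rw [show (fun ε : ℝ => A ε τ) = fun ε => N ε τ from funext fun ε => hAN ε τ]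
        exact hNlim hτI
      have hC' : Tendsto (fun ε : ℝ => Cc ε τ) (𝓝[>] 0) (𝓝 (2 * Ps τ)) :=
        enstrophyClock_limit_C hk (hST τ hτI) (hu2 hτ0) (hv2 hτ0) (hdiv hτ0)
      exact hA'.sub (hC'.const_mul ν)
  have hΦlim : Tendsto (fun ε : ℝ => N ε t' - N ε s - ∫ τ in s..t', (A ε τ - ν * Cc ε τ)) (𝓝[>] 0)
      (𝓝 (Ωs t' - Ωs s - ∫ τ in s..t', (Ωs τ - ν * (2 * Ps τ)))) :=
    ((hNlim ⟨hst, le_rfl⟩).sub (hNlim ⟨le_rfl, hst⟩)).sub hInt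
  have heq := tendsto_nhds_unique hΦlim hΦ0
  -- (4) back to the iterated functionals
  have eΩ : ∀ τ ∈ Icc s t', (∫ x in Ioc 0 L, ∫ y, vorticity (u τ) (v τ) x y ^ 2) = Ωs τ := fun τ hτ =>
    integral_iterated_eq_strip (enstrophyCeiling_integrableOn_sq hk (hST τ hτ) (hu2 (hpos hτ)) (hv2 (hpos hτ)))
  have eP : ∀ τ ∈ Icc s t', (∫ x in Ioc 0 L, ∫ y, (dX (vorticity (u τ) (v τ)) x y ^ 2 +
      dY (vorticity (u τ) (v τ)) x y ^ 2)) = Ps τ := fun τ hτ =>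
    integral_iterated_eq_strip (enstrophyClock_integrableOn_gradSq hk (hST τ hτ) (hu2 (hpos hτ)) (hv2 (hpos hτ))
      (hdiv (hpos hτ)))
  have eI : ∫ τ in s..t', ((∫ x in Ioc 0 L, ∫ y, vorticity (u τ) (v τ) x y ^ 2) -
      2 * ν * ∫ x in Ioc 0 L, ∫ y, (dX (vorticity (u τ) (v τ)) x y ^ 2 + dY (vorticity (u τ) (v τ)) x y ^ 2)) =
      ∫ τ in s..t', (Ωs τ - ν * (2 * Ps τ)) := by
    refine intervalIntegral.integral_congr fun τ hτ => ?_
    rw [uIcc_of_le hst] at hτ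
    rw [eΩ τ hτ, eP τ hτ]
    ring
  rw [eΩ t' ⟨hst, le_rfl⟩, eΩ s ⟨le_rfl, hst⟩, eI]
  linarith

end Identity

end Summit.AnomalousDissipation.AnomalousDissipation.Theorems.StrainedLayerLaw.LogEnstrophyClock

end
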